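import Literature.AlgebraicGeometry.Frobenioids.Thm49FunctorialPullbacks
import Literature.AlgebraicGeometry.Frobenioids.Thm42SubWeak
import HarnessLib

/-!
# [FrdI] Theorem 4.9, row T49-L04 (functoriality of `Ψ^Φ` along pull-back morphisms) in the WEAK setting

Mochizuki, *The geometry of Frobenioids I: the general theory*, Kyushu J. Math. **62** (2008)
293–400, §4, proof of Theorem 4.9, p. 89 ll. 33–36: "the functoriality of this isomorphism of monoids with
respect to pull-back morphisms follows immediately by “pulling back pre-steps”, as in Proposition 1.11, (v)"
[cite: MochizukiFrdI2008, Thm. 4.9 p.89].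

PROOF-ONLY file (cell abc-iut, layer L1, seat abc-iut-L1-t14; row «C411iii/iv-WEAK» = the [FrdI] Thm. 4.9 /
Cor. 4.11 (iii)(iv) chain over `IsPerfFactorialWeak`, block (T2)). WEAK-HYPOTHESIS TWINS of the three
`T42.Setting`-typed packagings of `Thm49FunctorialPullbacks.lean` (seat abc-iut-L1-t1), now over
`FrdI.T42.SettingWeak` (`Thm42SubWeak.lean`: "`Φ_i` perf-factorial" weakened to "`Φ_i` weakly perf-factorial",
Def. 2.4 (i) (a)(b)(c) + (d_ord) + (d_res); cell finding F-L2d2-1): `FrdI.T49.functorialPullbacks_weak`,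
`FrdI.T49.natural_of_baseIso_natural_weak`, `FrdI.T49.sufficesRightEqLeft_conclusion_of_baseIso_natural_weak`.
The hypothesis-free lemmas of the strong file (`PreFrobenioid.pull_natural_of_isPullbackMorphism`,
`pull_natural_of_baseIso_of_pullback`) are consumed BY NAME; only the fields `isFrobenioid_i`, `pullback_map` of
the setting enter, so the proofs are verbatim. No new definitions; nothing of the paper restated or strengthened;
nothing here is specific to the abc programme and no side is taken on [IUTchIII] Cor. 3.12.
-/

namespace Literature.AlgebraicGeometry.Frobenioids

open CategoryTheory Opposite

universe w v v' u u'

namespace FrdI.T49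

variable {D₁ : Type u} [Category.{v} D₁] {Φ₁ : D₁ᵒᵖ ⥤ CommMonCat.{w}} {C₁ : Type u'}
  [Category.{v'} C₁] {D₂ : Type u} [Category.{v} D₂] {Φ₂ : D₂ᵒᵖ ⥤ CommMonCat.{w}} {C₂ : Type u'}
  [Category.{v'} C₂] {F₁ : C₁ ⥤ ElemFrobenioid Φ₁} {F₂ : C₂ ⥤ ElemFrobenioid Φ₂} {Ψ : C₁ ≌ C₂}

/-- **T49-L04 `FunctorialPullbacks` in the WEAK setting** (twin of `functorialPullbacks`). In a
`T42.SettingWeak F₁ F₂ Ψ`, a family of monoid isomorphisms `m_A : Φ₁(A) ≃* Φ₂(Ψ A)` satisfying the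
pre-step clause `m_A(Div φ) = Div(Ψ φ)` (first clause of the conclusion of `SufficesRightEqLeft`)
is functorial with respect to pull-back morphisms (Prop. 1.11 (v); `Ψ` preserves pull-back
morphisms, Thm. 3.4 (iii) = `SettingWeak.pullback_map`). [cite: MochizukiFrdI2008, Thm. 4.9 p.89] -/
theorem functorialPullbacks_weak (S : T42.SettingWeak F₁ F₂ Ψ)
    (m : ∀ A : C₁, Φ₁.obj (op (PreFrobenioid.baseObj F₁ A)) ≃*
      Φ₂.obj (op (PreFrobenioid.baseObj F₂ (Ψ.functor.obj A))))
    (hm : ∀ ⦃A B : C₁⦄ (φ : A ⟶ B), PreFrobenioid.IsPreStep F₁ φ →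
      m A (PreFrobenioid.Div F₁ φ) = PreFrobenioid.Div F₂ (Ψ.functor.map φ))
    ⦃A B : C₁⦄ (φ : A ⟶ B) (hφ : PreFrobenioid.IsPullbackMorphism F₁ φ)
    (x : Φ₁.obj (op (PreFrobenioid.baseObj F₁ B))) :
    m A (pull Φ₁ (PreFrobenioid.Base F₁ φ) x) =
      pull Φ₂ (PreFrobenioid.Base F₂ (Ψ.functor.map φ)) (m B x) :=
  PreFrobenioid.pull_natural_of_isPullbackMorphism S.isFrobenioid₁ S.isFrobenioid₂ Ψ.functor
    S.pullback_map (fun A => m A) (fun _ _ φ h => hm φ h.2) φ hφ x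

/-- **The full second clause of `SufficesRightEqLeft`'s conclusion from its base-isomorphism
part, WEAK setting** (twin of `natural_of_baseIso_natural`). In a `T42.SettingWeak F₁ F₂ Ψ`, if the family `m_A : Φ₁(A) ≃* Φ₂(Ψ A)` satisfies the pre-step
clause and is functorial in `A ∈ Ob(C₁^bs-iso)` (naturality along base-isomorphisms — the output of
rows T49-L02/L03), then it is functorial along every morphism of `C₁` (pull-back morphisms by
`functorialPullbacks_weak`, then Def. 1.3 (iv)(a)). [cite: MochizukiFrdI2008, Thm. 4.9 p.89] -/
theorem natural_of_baseIso_natural_weak (S : T42.SettingWeak F₁ F₂ Ψ)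
    (m : ∀ A : C₁, Φ₁.obj (op (PreFrobenioid.baseObj F₁ A)) ≃*
      Φ₂.obj (op (PreFrobenioid.baseObj F₂ (Ψ.functor.obj A))))
    (hm : ∀ ⦃A B : C₁⦄ (φ : A ⟶ B), PreFrobenioid.IsPreStep F₁ φ →
      m A (PreFrobenioid.Div F₁ φ) = PreFrobenioid.Div F₂ (Ψ.functor.map φ))
    (hbs : ∀ ⦃A B : C₁⦄ (φ : A ⟶ B), PreFrobenioid.IsBaseIso F₁ φ →
      ∀ x : Φ₁.obj (op (PreFrobenioid.baseObj F₁ B)),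
        m A (pull Φ₁ (PreFrobenioid.Base F₁ φ) x) =
          pull Φ₂ (PreFrobenioid.Base F₂ (Ψ.functor.map φ)) (m B x))
    ⦃A B : C₁⦄ (φ : A ⟶ B) (x : Φ₁.obj (op (PreFrobenioid.baseObj F₁ B))) :
    m A (pull Φ₁ (PreFrobenioid.Base F₁ φ) x) =
      pull Φ₂ (PreFrobenioid.Base F₂ (Ψ.functor.map φ)) (m B x) :=
  PreFrobenioid.pull_natural_of_baseIso_of_pullback S.isFrobenioid₁ Ψ.functor (fun A => m A) hbs
    (functorialPullbacks_weak S m hm) φ x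

/-- **Packaging for `SufficesRightEqLeft`, WEAK setting** (twin of
`sufficesRightEqLeft_conclusion_of_baseIso_natural`). Given the pre-step clause and functoriality on
`C₁^bs-iso`, the family `m` satisfies BOTH clauses of the conclusion of
`FrdI.T49.SufficesRightEqLeft` (the `∃ m, … ∧ …` there is witnessed by `m`).
[cite: MochizukiFrdI2008, Thm. 4.9 p.89] -/
theorem sufficesRightEqLeft_conclusion_of_baseIso_natural_weak (S : T42.SettingWeak F₁ F₂ Ψ)
    (m : ∀ A : C₁, Φ₁.obj (op (PreFrobenioid.baseObj F₁ A)) ≃*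
      Φ₂.obj (op (PreFrobenioid.baseObj F₂ (Ψ.functor.obj A))))
    (hm : ∀ ⦃A B : C₁⦄ (φ : A ⟶ B), PreFrobenioid.IsPreStep F₁ φ →
      m A (PreFrobenioid.Div F₁ φ) = PreFrobenioid.Div F₂ (Ψ.functor.map φ))
    (hbs : ∀ ⦃A B : C₁⦄ (φ : A ⟶ B), PreFrobenioid.IsBaseIso F₁ φ →
      ∀ x : Φ₁.obj (op (PreFrobenioid.baseObj F₁ B)),
        m A (pull Φ₁ (PreFrobenioid.Base F₁ φ) x) =
          pull Φ₂ (PreFrobenioid.Base F₂ (Ψ.functor.map φ)) (m B x)) :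
    ∃ m : ∀ A : C₁, Φ₁.obj (op (PreFrobenioid.baseObj F₁ A)) ≃*
        Φ₂.obj (op (PreFrobenioid.baseObj F₂ (Ψ.functor.obj A))),
      (∀ ⦃A B : C₁⦄ (φ : A ⟶ B), PreFrobenioid.IsPreStep F₁ φ →
          m A (PreFrobenioid.Div F₁ φ) = PreFrobenioid.Div F₂ (Ψ.functor.map φ)) ∧
      ∀ ⦃A B : C₁⦄ (φ : A ⟶ B) (x : Φ₁.obj (op (PreFrobenioid.baseObj F₁ B))),
        m A (pull Φ₁ (PreFrobenioid.Base F₁ φ) x) =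
          pull Φ₂ (PreFrobenioid.Base F₂ (Ψ.functor.map φ)) (m B x) :=
  ⟨m, hm, natural_of_baseIso_natural_weak S m hm hbs⟩

end FrdI.T49

end Literature.AlgebraicGeometry.Frobenioids
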